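import Literature.NumberTheory.LFunctions.ConreyIwaniec2002CircleMethodModulus
import HarnessLib

/-!
# Conrey–Iwaniec (2002), Theorem 4.1 / Corollary 4.2: the assembly (stub S3b3 of SKELETON S3)

B. Conrey, H. Iwaniec, *Spacing of zeros of Hecke `L`-functions and the class number problem*,
Acta Arith. 103 (2002) 259–312, §4, Theorem 4.1 (4.17) and Corollary 4.2 (4.19) [held text
`paper:arxiv-math_0111012`, p0010:L60–p0011:L101]. This file closes the registered stub S3b3
`stub_circle_assembly` of SKELETON S3 (cell `landau-siegel/ls-inputs`, line `theta-circle-method`),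
statement VERBATIM:

`∀ c₁ K₀, 0 < c₁ → 0 < K₀ → BumpFourierDecay c₁ → ZeroDetectorIdentity →
   IncompleteKloostermanBound K₀ → ∃ c₀ > 0, CircleMethodBound c₀`,

i.e. Kloosterman's circle method "in an axiomatic setting": from the zero detector (4.10), the
incomplete Kloosterman sums (4.14), the decay (4.24) of `ĝ` (hence (4.8)–(4.9)), the summation
datum (4.3)–(4.7) in product form (`IsVoronoiDatum`) and the kernel bound (4.5) at `C = 2√(qX)`
(`KernelFourierBound`), for `X ≥ 1/2`, test functions `g₁, g₂` of (4.18) on `[X, 2X]` and `h ≥ 1`: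
`B(h) = Σ_{m−n=h}λ(m)λ̄(n)g₁(m)g₂(n) = σ(h)∫g₁(x+h)g₂(x)dx + O(τ(h)A²(X/√(qX) + qB²(qX)^{3/4}(1+log qX)²))`
with an absolute constant depending only on `c₁, K₀` (print: "the implied constant is absolute";
(4.17) with `C = 2√(qX)`: `τ(h)A²C^{-1}·X` from the tail `Σ_{c > C} r_c(h)p(c)²` of (4.16) times
`|∫g₁(x+h)g₂| ≤ X`, and `τ(h)A²B²C^{3/2}log²C`; the factor `q` of (4.17) is not needed for a datum
in product form and is kept, harmlessly, in `CircleMethodBound`).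

Proof = the chain of this line's toolkit: `dissection_trigSum` (4.10) ⇒ `B(h) = Σ_{c ≤ C'}Σ_d ∫₀^{1/cd}
(F(a_d/c − α) + F(−(a_d/c − α)))dα` with `F(θ) = e(−hθ)S₁(θ)S̄₂(θ)`, `C' = ⌊2√(qX)⌋`;
`norm_modulus_sub_main_le` per modulus; `sum_card_divisors_sqrt_gcd_div_sqrt_le`,
`sum_gcd_div_le`, `sum_gcd_div_sq_tail_le` for the sums over `c` and the tail of `σ(h)` (4.16).

## References

* [ConreyIwaniec2002] B. Conrey, H. Iwaniec, Acta Arith. 103 (2002) 259–312, arXiv:math/0111012: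
  §4 (4.1)–(4.19), Theorem 4.1, Corollary 4.2.
-/

noncomputable section

open scoped FourierTransform ComplexConjugate
open Complex MeasureTheory Set Finset

namespace Literature.NumberTheory.LFunctions

namespace ConreyIwaniec2002

namespace CircleMethod

open Literature.NumberTheory.Sieve (ramanujanSum ramanujanSum_im)
open Literature.NumberTheory.LFunctions.MatomakiMerikoski (norm_ramanujanSum_le_gcd)
open Literature.NumberTheory.Sieve.Vaughan (Ioc_zero_eq_Icc_one)

/-! ### `F(θ) = e(−hθ)S₁(θ)S̄₂(θ)` as a trigonometric sum and its constant term `B(h)` -/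

/-- `e(x)e(y) = e(x + y)` in `ℂ`. [folklore] -/
private theorem fourierChar_mul_eq' (x y : ℝ) : (𝐞 x : ℂ) * (𝐞 y : ℂ) = (𝐞 (x + y) : ℂ) := by
  rw [← Circle.coe_mul, ← AddChar.map_add_eq_mul]

/-- `conj e(x) = e(−x)`. [folklore] -/
private theorem conj_fourierChar_eq' (x : ℝ) : conj ((𝐞 x : ℂ)) = (𝐞 (-x) : ℂ) := by
  rw [← Circle.coe_inv_eq_conj, AddChar.map_neg_eq_inv]

/-- **`F(θ) = e(−hθ)S₁(θ)S̄₂(θ)` is the trigonometric sum `Σ_{m,n} λ(m)λ̄(n)g₁(m)g₂(n)e((m−n−h)θ)`**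
(`S₁(θ) = Σλ(m)g₁(m)e(mθ)`, `S₂(θ) = Σλ(n)conj(g₂(n))e(nθ)`; print's `|S(a/c − α)|²e(h(α − a/c))`
for the pair `g₁, g₂`). [cite: ConreyIwaniec2002, §4 (4.1)–(4.2), (4.10)–(4.12)] -/
theorem F_eq_trigSum {X : ℝ} (lam : ℕ → ℂ) (g₁ g₂ : ℝ → ℂ) (h : ℕ) (θ : ℝ) :
    (𝐞 (-(h * θ)) : ℂ) *
        ((∑ n ∈ Finset.Icc 1 ⌊2 * X⌋₊, lam n * g₁ n * (𝐞 (n * θ) : ℂ)) *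
          conj (∑ n ∈ Finset.Icc 1 ⌊2 * X⌋₊, lam n * conj (g₂ n) * (𝐞 (n * θ) : ℂ))) =
      ∑ mn ∈ Finset.Icc 1 ⌊2 * X⌋₊ ×ˢ Finset.Icc 1 ⌊2 * X⌋₊,
        (lam mn.1 * conj (lam mn.2) * g₁ mn.1 * g₂ mn.2) *
          (𝐞 ((((mn.1 : ℤ) - mn.2 - h : ℤ) : ℝ) * θ) : ℂ) := by
  rw [map_sum, Finset.sum_mul_sum]
  simp_rw [Finset.mul_sum]
  rw [← Finset.sum_product']
  refine Finset.sum_congr rfl fun mn _ ↦ ?_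
  rw [map_mul (starRingEnd ℂ), map_mul (starRingEnd ℂ), Complex.conj_conj, conj_fourierChar_eq']
  have : (𝐞 (-(h * θ)) : ℂ) * ((𝐞 (mn.1 * θ) : ℂ) * (𝐞 (-(mn.2 * θ)) : ℂ)) =
      (𝐞 ((((mn.1 : ℤ) - mn.2 - h : ℤ) : ℝ) * θ) : ℂ) := by
    rw [fourierChar_mul_eq', fourierChar_mul_eq']; congr 2; push_cast; ring
  rw [← this]
  ring

/-- **The constant term of `F` is `B(h)`**: `Σ_{m−n−h = 0} λ(m)λ̄(n)g₁(m)g₂(n) =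
Σ_{1 ≤ n ≤ 2X} λ(n+h)λ̄(n)g₁(n+h)g₂(n)` (the terms with `n + h > 2X` vanish as `g₁ = 0` off
`[X, 2X]`). [cite: ConreyIwaniec2002, §4 (4.1), (4.19)] -/
theorem constantTerm_eq_shiftedSum {X : ℝ} (hX : 1 / 2 ≤ X) (lam : ℕ → ℂ) {g₁ : ℝ → ℂ}
    (hg₁ : IsBumpOn X g₁) (g₂ : ℝ → ℂ) (h : ℕ) :
    ∑ mn ∈ (Finset.Icc 1 ⌊2 * X⌋₊ ×ˢ Finset.Icc 1 ⌊2 * X⌋₊).filter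
        (fun mn : ℕ × ℕ ↦ ((mn.1 : ℤ) - mn.2 - h : ℤ) = 0),
        lam mn.1 * conj (lam mn.2) * g₁ mn.1 * g₂ mn.2 =
      ∑ n ∈ Finset.Icc 1 ⌊2 * X⌋₊, lam (n + h) * conj (lam n) * g₁ ((n : ℝ) + h) * g₂ n := by
  rw [sum_filter_shift_eq (Finset.Icc 1 ⌊2 * X⌋₊) (Finset.Icc 1 ⌊2 * X⌋₊)
    (fun m n ↦ lam m * conj (lam n) * g₁ m * g₂ n) h]
  rw [Finset.sum_filter]
  refine Finset.sum_congr rfl fun n _ ↦ ?_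
  split_ifs with hmem
  · push_cast; ring_nf
  · rw [show ((n : ℝ) + h) = ((n + h : ℕ) : ℝ) by push_cast; ring, eq_zero_nat_of_isBumpOn hX hg₁ hmem]
    ring

/-! ### The singular series (4.16): summability and the tail beyond `C'` -/

/-- The terms of `σ(h) = Σ_c r_c(h)p(c)²` satisfy `|Re r_c(h)·p(c)²| ≤ (h,c)A²/c²` (`|r_c(h)| ≤ (h,c)`,
`0 ≤ p(c) ≤ A/c`). [cite: ConreyIwaniec2002, §4 (4.7), (4.16)] -/
theorem abs_sigma_term_le {A : ℝ} {lam : ℕ → ℂ} {kf : ℕ → ℕ → ℝ → ℂ} {p : ℕ → ℝ}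
    {u : ℕ → ℤ → ℂ} {φ : ℕ → ℕ → ℂ} {l : ℕ → ℕ → ℤ} (hV : IsVoronoiDatum A lam kf p u φ l)
    (h : ℕ) {c : ℕ} (hc : 1 ≤ c) :
    |(ramanujanSum c h).re * p c ^ 2| ≤ (Nat.gcd h c : ℝ) * A ^ 2 / (c : ℝ) ^ 2 := by
  obtain ⟨hp0, hpA, -, -⟩ := hV c hc
  have hc' : (0 : ℝ) < c := by exact_mod_cast hc
  have hr : |(ramanujanSum c h).re| ≤ (Nat.gcd h c : ℝ) := by
    refine (Complex.abs_re_le_norm _).trans ?_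
    have := norm_ramanujanSum_le_gcd c (h : ℤ)
    have e : Int.gcd (h : ℤ) c = Nat.gcd h c := by simp [Int.gcd]
    rw [e] at this
    exact this
  rw [abs_mul, abs_of_nonneg (sq_nonneg (p c))]
  have hp2 : p c ^ 2 ≤ (A / c) ^ 2 := pow_le_pow_left₀ hp0 hpA 2
  calc |(ramanujanSum c h).re| * p c ^ 2 ≤ (Nat.gcd h c : ℝ) * (A / c) ^ 2 :=
        mul_le_mul hr hp2 (sq_nonneg _) (Nat.cast_nonneg _)
    _ = (Nat.gcd h c : ℝ) * A ^ 2 / (c : ℝ) ^ 2 := by field_simp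

/-- **The tail of (4.16)**: `σ(h)` converges and
`|σ(h) − Σ_{c ≤ C'} Re r_c(h)·p(c)²| ≤ 2τ(h)A²/C'` for `C' ≥ 1`, `h ≥ 1` ("Finally we extend the
summation over `c ≤ C` to all `c` getting `Σ_{c ≤ C} r_c(h)p(c)² = σ(h) + O(τ(h)A²C^{-1})`").
[cite: ConreyIwaniec2002, §4 (4.16)] -/
theorem abs_ciSigma_sub_sum_le {A : ℝ} {lam : ℕ → ℂ} {kf : ℕ → ℕ → ℝ → ℂ} {p : ℕ → ℝ}
    {u : ℕ → ℤ → ℂ} {φ : ℕ → ℕ → ℂ} {l : ℕ → ℕ → ℤ} (hV : IsVoronoiDatum A lam kf p u φ l)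
    {h : ℕ} (hh : 1 ≤ h) {C' : ℕ} (hC' : 1 ≤ C') :
    |ciSigma p h - ∑ c ∈ Finset.Icc 1 C', (ramanujanSum c h).re * p c ^ 2| ≤
      2 * (h.divisors.card : ℝ) * A ^ 2 / C' := by
  set a : ℕ → ℝ := fun c ↦ (ramanujanSum c h).re * p c ^ 2 with ha
  -- summability of `c ↦ a (c+1)` by comparison with `h A² /(c+1)²`
  have hbd : ∀ c : ℕ, |a (c + 1)| ≤ (h : ℝ) * A ^ 2 * (1 / ((c + 1 : ℕ) : ℝ) ^ 2) := by
    intro c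
    refine (abs_sigma_term_le hV h (by omega)).trans ?_
    have hg : (Nat.gcd h (c + 1) : ℝ) ≤ h := by
      exact_mod_cast Nat.le_of_dvd (by omega) (Nat.gcd_dvd_left h (c + 1))
    have : (0 : ℝ) < ((c + 1 : ℕ) : ℝ) ^ 2 := by positivity
    rw [div_eq_mul_one_div]
    gcongr
  have hs0 : Summable (fun c : ℕ ↦ (h : ℝ) * A ^ 2 * (1 / ((c + 1 : ℕ) : ℝ) ^ 2)) := by
    have := (summable_nat_add_iff 1).mpr (Real.summable_one_div_nat_pow.mpr one_lt_two)
    exact this.mul_left _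
  have hsa : Summable (fun c : ℕ ↦ a (c + 1)) :=
    Summable.of_norm_bounded hs0 (fun c ↦ by rw [Real.norm_eq_abs]; exact hbd c)
  -- split off the first `C'` terms
  have hsplit := hsa.sum_add_tsum_nat_add C'
  have hfin : ∑ i ∈ Finset.range C', a (i + 1) = ∑ c ∈ Finset.Icc 1 C', a c := by
    rw [Finset.range_eq_Ico, Finset.sum_Ico_add' a 0 C' 1, zero_add]
    exact Finset.sum_congr (by ext c; simp only [Finset.mem_Ico, Finset.mem_Icc]; omega)
      fun _ _ ↦ rfl
  have hσ : ciSigma p h = ∑' c : ℕ, a (c + 1) := rfl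
  rw [hσ, ← hsplit, hfin, add_sub_cancel_left]
  -- the tail, by the partial-sum bound `Σ_{C' < c ≤ N} (h,c)/c² ≤ 2τ(h)/C'`
  have htail : ∀ s : Finset ℕ, ∑ i ∈ s, |a (i + C' + 1)| ≤ 2 * (h.divisors.card : ℝ) * A ^ 2 / C' := by
    intro s
    classical
    -- map `i ↦ i + C' + 1` into `Ioc C' N`
    set N := s.sup id + C' + 1 with hN
    calc ∑ i ∈ s, |a (i + C' + 1)|
        ≤ ∑ i ∈ s, (Nat.gcd h (i + C' + 1) : ℝ) * A ^ 2 / ((i + C' + 1 : ℕ) : ℝ) ^ 2 :=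
          Finset.sum_le_sum fun i _ ↦ abs_sigma_term_le hV h (by omega)
      _ = ∑ c ∈ s.map (addRightEmbedding (C' + 1)),
            (Nat.gcd h c : ℝ) * A ^ 2 / (c : ℝ) ^ 2 := by
          rw [Finset.sum_map]; rfl
      _ ≤ ∑ c ∈ Finset.Ioc C' N, (Nat.gcd h c : ℝ) * A ^ 2 / (c : ℝ) ^ 2 := by
          refine Finset.sum_le_sum_of_subset_of_nonneg (fun c hc ↦ ?_) (fun _ _ _ ↦ by positivity)
          rw [Finset.mem_map] at hc
          obtain ⟨i, hi, rfl⟩ := hc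
          simp only [addRightEmbedding_apply, Finset.mem_Ioc]
          exact ⟨by omega, by have := Finset.le_sup (f := id) hi; simp only [id] at this; omega⟩
      _ = A ^ 2 * ∑ c ∈ Finset.Ioc C' N, (Nat.gcd h c : ℝ) / (c : ℝ) ^ 2 := by
          rw [Finset.mul_sum]; exact Finset.sum_congr rfl fun c _ ↦ by ring
      _ ≤ A ^ 2 * (2 * (h.divisors.card : ℝ) / C') :=
          mul_le_mul_of_nonneg_left (sum_gcd_div_sq_tail_le (by omega) hC' N) (sq_nonneg _)
      _ = 2 * (h.divisors.card : ℝ) * A ^ 2 / C' := by ring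
  have hs2 : Summable (fun i : ℕ ↦ a (i + C' + 1)) := (summable_nat_add_iff C').mpr hsa
  calc |∑' i : ℕ, a (i + C' + 1)| = ‖∑' i : ℕ, a (i + C' + 1)‖ := (Real.norm_eq_abs _).symm
    _ ≤ ∑' i : ℕ, ‖a (i + C' + 1)‖ := norm_tsum_le_tsum_norm hs2.norm
    _ ≤ 2 * (h.divisors.card : ℝ) * A ^ 2 / C' :=
        tsum_le_of_sum_le' (by positivity) fun s ↦ by simpa only [Real.norm_eq_abs] using htail s

/-! ### Theorem 4.1 / Corollary 4.2 -/

/-- `(qX)^{3/4} = s√s` with `s = √(qX)`. [folklore] -/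
private theorem rpow_three_quarters_eq {y : ℝ} (hy : 0 < y) :
    y ^ (3 / 4 : ℝ) = Real.sqrt y * Real.sqrt (Real.sqrt y) := by
  rw [Real.sqrt_eq_rpow, Real.sqrt_eq_rpow, ← Real.rpow_mul hy.le, ← Real.rpow_add hy]
  norm_num

/-- Pure-real bookkeeping for one modulus: `(K₀τ√g√c·lc/c)·Q_c + R·g/c ≤ K₀·lC·Qmax·(τ√g/√c) + R·(g/c)`.
[folklore] -/
private theorem per_modulus_alg {K₀ τc sg sc c lc lC A B C Ks c₁ I₂ I₃ C' C'1 g : ℝ}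
    (hK₀ : 0 ≤ K₀) (hτ : 0 ≤ τc) (hsg : 0 ≤ sg) (hsc0 : 0 < sc) (hsc : sc * sc = c)
    (hlc0 : 0 ≤ lc) (hl : lc ≤ lC) (hcC' : c ≤ C') (hA : 0 ≤ A) (hB : 0 ≤ B) (hC : 0 ≤ C)
    (hKs : 0 ≤ Ks) (hc₁ : 0 ≤ c₁) (hI₂ : 0 ≤ I₂) (hI₃ : 0 ≤ I₃) (hC'1 : 0 < C'1) :
    (K₀ * τc * sg * sc * lc) / c *
        (A * (A * B * C * Ks) * (2 * (c₁ * I₂)) + 2 * (A * B * C * Ks) ^ 2 / C'1 +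
          A ^ 2 * (c + C') * (c₁ ^ 2 * I₃)) + A ^ 2 * (c₁ ^ 2 * I₃) * C'1 * g / c ≤
      K₀ * lC * (A * (A * B * C * Ks) * (2 * (c₁ * I₂)) + 2 * (A * B * C * Ks) ^ 2 / C'1 +
          A ^ 2 * (2 * C') * (c₁ ^ 2 * I₃)) * (τc * sg / sc) +
        A ^ 2 * (c₁ ^ 2 * I₃) * C'1 * (g / c) := by
  subst hsc
  have hsc' : sc ≠ 0 := hsc0.ne'
  have hC'0 : 0 ≤ C' := le_trans (mul_self_nonneg sc) hcC'
  set Qc := A * (A * B * C * Ks) * (2 * (c₁ * I₂)) + 2 * (A * B * C * Ks) ^ 2 / C'1 +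
    A ^ 2 * (sc * sc + C') * (c₁ ^ 2 * I₃) with hQc
  set Qmax := A * (A * B * C * Ks) * (2 * (c₁ * I₂)) + 2 * (A * B * C * Ks) ^ 2 / C'1 +
    A ^ 2 * (2 * C') * (c₁ ^ 2 * I₃) with hQmax
  have hQc0 : 0 ≤ Qc := by positivity
  have hQ : Qc ≤ Qmax := by
    rw [hQc, hQmax]
    have : A ^ 2 * (sc * sc + C') * (c₁ ^ 2 * I₃) ≤ A ^ 2 * (2 * C') * (c₁ ^ 2 * I₃) :=
      mul_le_mul_of_nonneg_right (mul_le_mul_of_nonneg_left (by linarith) (by positivity))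
        (by positivity)
    linarith
  have e : K₀ * τc * sg * sc * lc / (sc * sc) * Qc = K₀ * lc * Qc * (τc * sg / sc) := by
    field_simp
  have e2 : A ^ 2 * (c₁ ^ 2 * I₃) * C'1 * g / (sc * sc) =
      A ^ 2 * (c₁ ^ 2 * I₃) * C'1 * (g / (sc * sc)) := by ring
  rw [e, e2]
  have hw : 0 ≤ τc * sg / sc := by positivity
  have h1 : K₀ * lc ≤ K₀ * lC := mul_le_mul_of_nonneg_left hl hK₀
  have h2 : K₀ * lc * Qc ≤ K₀ * lC * Qmax :=
    mul_le_mul h1 hQ hQc0 (mul_nonneg hK₀ (hlc0.trans hl))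
  have h3 := mul_le_mul_of_nonneg_right h2 hw
  linarith

/-- Pure-real bookkeeping: the uniform constant `Qmax ≤ 4A²B²s·κ` (`C = 2s ≤ C' + 1`, `C' ≤ 2s`).
[folklore] -/
private theorem qmax_alg {A B s c₁ I₂ I₃ Ks C' : ℝ} (hA : 1 ≤ A) (hB : 1 ≤ B) (hs : 1 ≤ s)
    (hc₁ : 0 ≤ c₁) (hI₂ : 0 ≤ I₂) (hI₃ : 0 ≤ I₃) (hKs : 0 ≤ Ks) (hC'2s : C' ≤ 2 * s)
    (h2s : 2 * s ≤ C' + 1) :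
    A * (A * B * (2 * s) * Ks) * (2 * (c₁ * I₂)) + 2 * (A * B * (2 * s) * Ks) ^ 2 / (C' + 1) +
        A ^ 2 * (2 * C') * (c₁ ^ 2 * I₃) ≤
      4 * A ^ 2 * B ^ 2 * s * (c₁ * I₂ * Ks + Ks ^ 2 + c₁ ^ 2 * I₃) := by
  have hA0 : 0 ≤ A := by linarith
  have hs0 : 0 < s := by linarith
  have hB' : B ≤ B ^ 2 := by nlinarith
  have hB1 : 1 ≤ B ^ 2 := by nlinarith
  have t1 : A * (A * B * (2 * s) * Ks) * (2 * (c₁ * I₂)) ≤ 4 * A ^ 2 * B ^ 2 * s * (c₁ * I₂ * Ks) := by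
    have e : A * (A * B * (2 * s) * Ks) * (2 * (c₁ * I₂)) = B * (4 * A ^ 2 * s * (c₁ * I₂ * Ks)) := by
      ring
    rw [e, show 4 * A ^ 2 * B ^ 2 * s * (c₁ * I₂ * Ks) = B ^ 2 * (4 * A ^ 2 * s * (c₁ * I₂ * Ks)) by
      ring]
    exact mul_le_mul_of_nonneg_right hB' (by positivity)
  have t2 : 2 * (A * B * (2 * s) * Ks) ^ 2 / (C' + 1) ≤ 4 * A ^ 2 * B ^ 2 * s * Ks ^ 2 := by
    rw [div_le_iff₀ (by linarith)]
    have h0 : 0 ≤ 4 * A ^ 2 * B ^ 2 * s * Ks ^ 2 := by positivity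
    have e : 2 * (A * B * (2 * s) * Ks) ^ 2 = (4 * A ^ 2 * B ^ 2 * s * Ks ^ 2) * (2 * s) := by ring
    rw [e]
    exact mul_le_mul_of_nonneg_left h2s h0
  have t3 : A ^ 2 * (2 * C') * (c₁ ^ 2 * I₃) ≤ 4 * A ^ 2 * B ^ 2 * s * (c₁ ^ 2 * I₃) := by
    have e1 : A ^ 2 * (2 * C') * (c₁ ^ 2 * I₃) ≤ A ^ 2 * (4 * s) * (c₁ ^ 2 * I₃) :=
      mul_le_mul_of_nonneg_right (mul_le_mul_of_nonneg_left (by linarith) (by positivity))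
        (by positivity)
    have e2 : A ^ 2 * (4 * s) * (c₁ ^ 2 * I₃) = 1 * (4 * A ^ 2 * s * (c₁ ^ 2 * I₃)) := by ring
    have e3 : 4 * A ^ 2 * B ^ 2 * s * (c₁ ^ 2 * I₃) = B ^ 2 * (4 * A ^ 2 * s * (c₁ ^ 2 * I₃)) := by
      ring
    rw [e2] at e1; rw [e3]
    exact e1.trans (mul_le_mul_of_nonneg_right hB1 (by positivity))
  linarith

/-- Pure-real bookkeeping: the final absorption of the three error pieces into
`c₀ τ(h) A² (X/√(qX) + qB²(qX)^{3/4}(1 + log qX)²)`. [folklore] -/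
private theorem final_alg {K₀ κ k₃ T A B s L X q C' lC sqC Qmax : ℝ} (hK₀ : 0 ≤ K₀) (hκ : 0 ≤ κ)
    (hk₃ : 0 ≤ k₃) (hT : 0 ≤ T) (hA : 1 ≤ A) (hB : 1 ≤ B) (hs : 1 ≤ s) (hL : 1 ≤ L) (hX : 0 < X)
    (hq : 1 ≤ q) (hsC' : s ≤ C') (hC'2s : C' ≤ 2 * s) (hlC : lC ≤ 2 * L) (hlC0 : 0 ≤ lC)
    (hsqC : sqC ≤ 2 * Real.sqrt s) (hsqC0 : 0 ≤ sqC) (hQ : Qmax ≤ 4 * A ^ 2 * B ^ 2 * s * κ)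
    (hQ0 : 0 ≤ Qmax) :
    K₀ * lC * Qmax * (4 * T * sqC * lC) + A ^ 2 * k₃ * (C' + 1) * (T * lC) + 2 * T * A ^ 2 / C' * X ≤
      (2 + 128 * K₀ * κ + 6 * k₃) * T * A ^ 2 *
        (X / s + q * B ^ 2 * (s * Real.sqrt s) * L ^ 2) := by
  have hs0 : 0 < s := by linarith
  have hA0 : 0 ≤ A := by linarith
  have hsq1 : 1 ≤ Real.sqrt s := Real.one_le_sqrt.mpr hs
  have hB1 : 1 ≤ B ^ 2 := by nlinarith
  set V : ℝ := T * A ^ 2 * B ^ 2 * s * Real.sqrt s * L ^ 2 with hV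
  set P : ℝ := T * A ^ 2 * X / s with hP
  have hV0 : 0 ≤ V := by positivity
  have hP0 : 0 ≤ P := by positivity
  -- piece 1
  have hE1 : K₀ * lC * Qmax * (4 * T * sqC * lC) ≤ 128 * K₀ * κ * V := by
    have a1 : K₀ * lC ≤ K₀ * (2 * L) := mul_le_mul_of_nonneg_left hlC hK₀
    have a2 : K₀ * lC * Qmax ≤ K₀ * (2 * L) * (4 * A ^ 2 * B ^ 2 * s * κ) :=
      mul_le_mul a1 hQ hQ0 (by positivity)
    have a3 : 4 * T * sqC * lC ≤ 4 * T * (2 * Real.sqrt s) * (2 * L) :=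
      mul_le_mul (mul_le_mul_of_nonneg_left hsqC (by positivity)) hlC hlC0 (by positivity)
    have a4 := mul_le_mul a2 a3 (by positivity) (by positivity)
    refine a4.trans (le_of_eq ?_)
    rw [hV]; ring
  -- piece 2
  have hE2 : A ^ 2 * k₃ * (C' + 1) * (T * lC) ≤ 6 * k₃ * V := by
    have a1 : C' + 1 ≤ 3 * s := by linarith
    have a2 : T * lC ≤ T * (2 * L) := mul_le_mul_of_nonneg_left hlC hT
    have a3 : A ^ 2 * k₃ * (C' + 1) * (T * lC) ≤ A ^ 2 * k₃ * (3 * s) * (T * (2 * L)) :=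
      mul_le_mul (mul_le_mul_of_nonneg_left a1 (by positivity)) a2 (by positivity) (by positivity)
    refine a3.trans ?_
    have e : A ^ 2 * k₃ * (3 * s) * (T * (2 * L)) = 6 * k₃ * (T * A ^ 2 * s * L) := by ring
    rw [e, hV]
    refine mul_le_mul_of_nonneg_left ?_ (by positivity)
    have e2 : T * A ^ 2 * s * L = (T * A ^ 2 * s * L) * 1 * 1 * 1 := by ring
    have e3 : T * A ^ 2 * B ^ 2 * s * Real.sqrt s * L ^ 2 =
        (T * A ^ 2 * s * L) * B ^ 2 * Real.sqrt s * L := by ring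
    rw [e2, e3]
    have h0 : 0 ≤ T * A ^ 2 * s * L := by positivity
    exact mul_le_mul (mul_le_mul (mul_le_mul_of_nonneg_left hB1 h0) hsq1 zero_le_one
      (by positivity)) hL zero_le_one (by positivity)
  -- piece 3
  have hE3 : 2 * T * A ^ 2 / C' * X ≤ 2 * P := by
    rw [hP, div_mul_eq_mul_div, show 2 * (T * A ^ 2 * X / s) = 2 * T * A ^ 2 * X / s by ring]
    exact div_le_div_of_nonneg_left (by positivity) hs0 hsC'
  -- the right-hand side dominates `2P + (128K₀κ + 6k₃)V`
  have hqV : V ≤ T * A ^ 2 * (q * B ^ 2 * (s * Real.sqrt s) * L ^ 2) := by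
    have e1 : V = 1 * (T * A ^ 2 * (B ^ 2 * (s * Real.sqrt s) * L ^ 2)) := by rw [hV]; ring
    have e2 : T * A ^ 2 * (q * B ^ 2 * (s * Real.sqrt s) * L ^ 2) =
        q * (T * A ^ 2 * (B ^ 2 * (s * Real.sqrt s) * L ^ 2)) := by ring
    rw [e1, e2]
    exact mul_le_mul_of_nonneg_right hq (by positivity)
  have hPe : T * A ^ 2 * (X / s) = P := by rw [hP]; ring
  have hk0 : 0 ≤ 128 * K₀ * κ + 6 * k₃ := by positivity
  have htot : (2 + 128 * K₀ * κ + 6 * k₃) * T * A ^ 2 * (X / s + q * B ^ 2 * (s * Real.sqrt s) * L ^ 2) =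
      (2 + 128 * K₀ * κ + 6 * k₃) * (P + T * A ^ 2 * (q * B ^ 2 * (s * Real.sqrt s) * L ^ 2)) := by
    rw [← hPe]; ring
  rw [htot]
  nlinarith [mul_nonneg hk0 hP0, mul_nonneg hk0 (sub_nonneg.mpr hqV), hV0, hP0,
    sub_nonneg.mpr hqV, mul_nonneg hk0 hV0]

/-- **S3b3 — THEOREM 4.1 / COROLLARY 4.2 (Kloosterman's circle method, generic in `λ`), the
assembly from (4.10), (4.14), (4.24)** (registered stub `stub_circle_assembly` of SKELETON S3,
statement verbatim): `BumpFourierDecay c₁ → ZeroDetectorIdentity → IncompleteKloostermanBound K₀ →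
∃ c₀ > 0, CircleMethodBound c₀`. The constant is
`c₀ = 2 + 128K₀(c₁I₂K₅₄² + K₅₄⁴ + c₁²I₃) + 6c₁²I₃` (`I₂ = ∫(1+|u|)^{-2}`, `I₃ = ∫(1+|u|)^{-3}`,
`K₅₄ = Σn^{-5/4}`). No claim about Landau–Siegel zeros.
[cite: ConreyIwaniec2002, Theorem 4.1 (4.17), Corollary 4.2 (4.19)] -/
theorem circle_assembly :
    ∀ (c₁ K₀ : ℝ), 0 < c₁ → 0 < K₀ → BumpFourierDecay c₁ → ZeroDetectorIdentity →
      IncompleteKloostermanBound K₀ → ∃ c₀ : ℝ, 0 < c₀ ∧ CircleMethodBound c₀ := by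
  intro c₁ K₀ hc₁ hK₀ hFd hZ hKl
  -- the absolute constants
  have hI₂0 : 0 ≤ ∫ u : ℝ, ((1 + |u|) ^ 2)⁻¹ := integral_nonneg fun u ↦ by positivity
  have hI₃0 : 0 ≤ ∫ u : ℝ, ((1 + |u|) ^ 3)⁻¹ := integral_nonneg fun u ↦ by positivity
  have hKs0 : 0 ≤ (∑' n : ℕ, (n : ℝ) ^ (-(5 / 4 : ℝ))) ^ 2 := sq_nonneg _
  refine ⟨2 + 128 * K₀ * (c₁ * (∫ u : ℝ, ((1 + |u|) ^ 2)⁻¹) * (∑' n : ℕ, (n : ℝ) ^ (-(5 / 4 : ℝ))) ^ 2 +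
      ((∑' n : ℕ, (n : ℝ) ^ (-(5 / 4 : ℝ))) ^ 2) ^ 2 + c₁ ^ 2 * ∫ u : ℝ, ((1 + |u|) ^ 3)⁻¹) +
      6 * (c₁ ^ 2 * ∫ u : ℝ, ((1 + |u|) ^ 3)⁻¹), by positivity, ?_⟩
  intro q hq A B hA hB lam kf p u φ l hV hK X hX g₁ g₂ hg₁ hg₂ h hh
  classical
  -- parameters: `s = √(qX) ≥ 1`, `C = 2s`, `C' = ⌊C⌋`
  have hX0 : 0 < X := by linarith
  have hq1 : (1 : ℝ) ≤ q := by exact_mod_cast (le_trans one_le_two hq)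
  have hq2 : (2 : ℝ) ≤ q := by exact_mod_cast hq
  have hqX1 : 1 ≤ (q : ℝ) * X := by nlinarith
  have hs1 : 1 ≤ Real.sqrt (q * X) := Real.one_le_sqrt.mpr hqX1
  have hs0 : 0 < Real.sqrt (q * X) := by linarith
  have hss : Real.sqrt (q * X) * Real.sqrt (q * X) = q * X := Real.mul_self_sqrt (by positivity)
  have hC'C : ((⌊2 * Real.sqrt (q * X)⌋₊ : ℕ) : ℝ) ≤ 2 * Real.sqrt (q * X) :=
    Nat.floor_le (by positivity)
  have hCC' : 2 * Real.sqrt (q * X) ≤ (⌊2 * Real.sqrt (q * X)⌋₊ : ℕ) + 1 :=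
    (Nat.lt_floor_add_one _).le
  have hC'1 : 1 ≤ ⌊2 * Real.sqrt (q * X)⌋₊ := Nat.le_floor (by push_cast; linarith)
  have hC'pos : (0 : ℝ) < (⌊2 * Real.sqrt (q * X)⌋₊ : ℕ) := by exact_mod_cast hC'1
  have hsC' : Real.sqrt (q * X) ≤ (⌊2 * Real.sqrt (q * X)⌋₊ : ℕ) := by linarith
  -- logarithms: `1 + log C' ≤ 2L`, `L = 1 + log(qX) = 1 + 2 log s ≥ 1`
  have hlogs : 0 ≤ Real.log (Real.sqrt (q * X)) := Real.log_nonneg hs1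
  have hLs : 1 + Real.log (q * X) = 1 + 2 * Real.log (Real.sqrt (q * X)) := by
    conv_lhs => rw [← hss]
    rw [Real.log_mul hs0.ne' hs0.ne']; ring
  have hL1 : 1 ≤ 1 + Real.log (q * X) := by rw [hLs]; linarith
  have hlogC' : 1 + Real.log ((⌊2 * Real.sqrt (q * X)⌋₊ : ℕ) : ℝ) ≤ 2 * (1 + Real.log (q * X)) := by
    have h1 : Real.log ((⌊2 * Real.sqrt (q * X)⌋₊ : ℕ) : ℝ) ≤ Real.log (2 * Real.sqrt (q * X)) :=
      Real.log_le_log hC'pos hC'C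
    rw [Real.log_mul two_ne_zero hs0.ne'] at h1
    have h2 : Real.log 2 ≤ 1 := by
      have := Real.log_two_lt_d9; norm_num at this; linarith
    rw [hLs]; linarith
  have hlogC'0 : 0 ≤ 1 + Real.log ((⌊2 * Real.sqrt (q * X)⌋₊ : ℕ) : ℝ) := by
    have := Real.log_nonneg (show (1 : ℝ) ≤ ((⌊2 * Real.sqrt (q * X)⌋₊ : ℕ) : ℝ) by
      exact_mod_cast hC'1)
    linarith
  have hsqC' : Real.sqrt ((⌊2 * Real.sqrt (q * X)⌋₊ : ℕ) : ℝ) ≤ 2 * Real.sqrt (Real.sqrt (q * X)) := by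
    calc Real.sqrt ((⌊2 * Real.sqrt (q * X)⌋₊ : ℕ) : ℝ) ≤ Real.sqrt (2 * Real.sqrt (q * X)) :=
          Real.sqrt_le_sqrt hC'C
      _ ≤ Real.sqrt (4 * Real.sqrt (q * X)) := Real.sqrt_le_sqrt (by linarith)
      _ = 2 * Real.sqrt (Real.sqrt (q * X)) := by
          rw [Real.sqrt_mul (by norm_num), show (4 : ℝ) = 2 ^ 2 by norm_num,
            Real.sqrt_sq (by norm_num)]
  have h34 : ((q : ℝ) * X) ^ (3 / 4 : ℝ) = Real.sqrt (q * X) * Real.sqrt (Real.sqrt (q * X)) :=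
    rpow_three_quarters_eq (by positivity)
  -- the trigonometric polynomial `F` and the dissection: `B(h) = Σ_c Σ_d ∫ (F⁺ + F⁻)`
  set C' : ℕ := ⌊2 * Real.sqrt (q * X)⌋₊ with hC'def
  set F : ℝ → ℂ := fun θ ↦ (𝐞 (-(h * θ)) : ℂ) *
      ((∑ n ∈ Finset.Icc 1 ⌊2 * X⌋₊, lam n * g₁ n * (𝐞 (n * θ) : ℂ)) *
        conj (∑ n ∈ Finset.Icc 1 ⌊2 * X⌋₊, lam n * conj (g₂ n) * (𝐞 (n * θ) : ℂ))) with hFdef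
  have hF : ∀ θ : ℝ, F θ = (𝐞 (-(h * θ)) : ℂ) *
      ((∑ n ∈ Finset.Icc 1 ⌊2 * X⌋₊, lam n * g₁ n * (𝐞 (n * θ) : ℂ)) *
        conj (∑ n ∈ Finset.Icc 1 ⌊2 * X⌋₊, lam n * conj (g₂ n) * (𝐞 (n * θ) : ℂ))) := fun θ ↦ rfl
  have hBh : (∑ n ∈ Finset.Icc 1 ⌊2 * X⌋₊,
        lam (n + h) * starRingEnd ℂ (lam n) * g₁ ((n : ℝ) + h) * g₂ n) =
      ∑ c ∈ Finset.Icc 1 C', ∑ d ∈ (Finset.Ioc C' (c + C')).filter (fun d ↦ Nat.Coprime c d),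
        ∫ α in (0 : ℝ)..(1 / ((c : ℝ) * d)),
          (F (((((d : ZMod c)⁻¹).val : ℝ)) / c - α) + F (-(((((d : ZMod c)⁻¹).val : ℝ)) / c - α))) := by
    rw [dissection_trigSum hZ hC'1 (Finset.Icc 1 ⌊2 * X⌋₊ ×ˢ Finset.Icc 1 ⌊2 * X⌋₊)
      (fun mn : ℕ × ℕ ↦ lam mn.1 * conj (lam mn.2) * g₁ mn.1 * g₂ mn.2)
      (fun mn : ℕ × ℕ ↦ ((mn.1 : ℤ) - mn.2 - h)) F (fun θ ↦ F_eq_trigSum lam g₁ g₂ h θ),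
      constantTerm_eq_shiftedSum hX lam hg₁ g₂ h]
  -- the leading term: `Σ_{c ≤ C'} p(c)² r_c(h)` against `σ(h)`
  set J : ℂ := ∫ x : ℝ, g₁ (x + h) * g₂ x with hJ
  have hJX : ‖J‖ ≤ X := norm_integral_shift_mul_le hX hg₁ hg₂ h
  have hT0 : (0 : ℝ) ≤ (h.divisors.card : ℝ) := Nat.cast_nonneg _
  have hmain_re : ∀ c : ℕ, (p c : ℂ) ^ 2 * ramanujanSum c h =
      (((ramanujanSum c h).re * p c ^ 2 : ℝ) : ℂ) := by
    intro c
    have him : ramanujanSum c h = ((ramanujanSum c h).re : ℂ) := by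
      apply Complex.ext <;> simp [ramanujanSum_im]
    conv_lhs => rw [him]
    push_cast
    ring
  have hsig : ‖(∑ c ∈ Finset.Icc 1 C', (p c : ℂ) ^ 2 * ramanujanSum c h) * J -
      (ciSigma p h : ℂ) * J‖ ≤ 2 * (h.divisors.card : ℝ) * A ^ 2 / C' * X := by
    rw [← sub_mul, norm_mul]
    refine mul_le_mul ?_ hJX (norm_nonneg _) (by positivity)
    rw [Finset.sum_congr rfl fun c _ ↦ hmain_re c, ← Complex.ofReal_sum, ← Complex.ofReal_sub,
      Complex.norm_real, Real.norm_eq_abs, abs_sub_comm]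
    exact abs_ciSigma_sub_sum_le hV hh hC'1
  -- per modulus, then summed over `c ≤ C'`
  have hh0 : h ≠ 0 := by omega
  have hwsum : ∑ c ∈ Finset.Icc 1 C', ((c.divisors.card : ℝ) * Real.sqrt (Nat.gcd h c) / Real.sqrt c) ≤
      4 * (h.divisors.card : ℝ) * Real.sqrt C' * (1 + Real.log C') := by
    rw [← Ioc_zero_eq_Icc_one]; exact sum_card_divisors_sqrt_gcd_div_sqrt_le hh0 C'
  have hgsum : ∑ c ∈ Finset.Icc 1 C', ((Nat.gcd h c : ℝ) / c) ≤
      (h.divisors.card : ℝ) * (1 + Real.log C') := by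
    rw [← Ioc_zero_eq_Icc_one]; exact sum_gcd_div_le hh0 C'
  have hA0 : 0 ≤ A := by linarith
  have hB0 : 0 ≤ B := by linarith
  have hE : ∑ c ∈ Finset.Icc 1 C',
      ‖(∑ d ∈ (Finset.Ioc C' (c + C')).filter (fun d ↦ Nat.Coprime c d),
          ∫ α in (0 : ℝ)..(1 / ((c : ℝ) * d)),
            (F (((((d : ZMod c)⁻¹).val : ℝ)) / c - α) + F (-(((((d : ZMod c)⁻¹).val : ℝ)) / c - α)))) -
        (p c : ℂ) ^ 2 * ramanujanSum c h * J‖ ≤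
      K₀ * (1 + Real.log C') *
          (A * (A * B * (2 * Real.sqrt (q * X)) * (∑' n : ℕ, (n : ℝ) ^ (-(5 / 4 : ℝ))) ^ 2) *
              (2 * (c₁ * ∫ u : ℝ, ((1 + |u|) ^ 2)⁻¹)) +
            2 * (A * B * (2 * Real.sqrt (q * X)) * (∑' n : ℕ, (n : ℝ) ^ (-(5 / 4 : ℝ))) ^ 2) ^ 2 /
              ((C' : ℝ) + 1) +
            A ^ 2 * (2 * (C' : ℝ)) * (c₁ ^ 2 * ∫ u : ℝ, ((1 + |u|) ^ 3)⁻¹)) *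
          (4 * (h.divisors.card : ℝ) * Real.sqrt C' * (1 + Real.log C')) +
        A ^ 2 * (c₁ ^ 2 * ∫ u : ℝ, ((1 + |u|) ^ 3)⁻¹) * ((C' : ℝ) + 1) *
          ((h.divisors.card : ℝ) * (1 + Real.log C')) := by
    calc _ ≤ ∑ c ∈ Finset.Icc 1 C', (K₀ * (1 + Real.log C') *
          (A * (A * B * (2 * Real.sqrt (q * X)) * (∑' n : ℕ, (n : ℝ) ^ (-(5 / 4 : ℝ))) ^ 2) *
              (2 * (c₁ * ∫ u : ℝ, ((1 + |u|) ^ 2)⁻¹)) +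
            2 * (A * B * (2 * Real.sqrt (q * X)) * (∑' n : ℕ, (n : ℝ) ^ (-(5 / 4 : ℝ))) ^ 2) ^ 2 /
              ((C' : ℝ) + 1) +
            A ^ 2 * (2 * (C' : ℝ)) * (c₁ ^ 2 * ∫ u : ℝ, ((1 + |u|) ^ 3)⁻¹)) *
            ((c.divisors.card : ℝ) * Real.sqrt (Nat.gcd h c) / Real.sqrt c) +
          A ^ 2 * (c₁ ^ 2 * ∫ u : ℝ, ((1 + |u|) ^ 3)⁻¹) * ((C' : ℝ) + 1) * ((Nat.gcd h c : ℝ) / c)) := by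
          refine Finset.sum_le_sum fun c hc ↦ ?_
          have hc' := Finset.mem_Icc.mp hc
          have hcpos : (0 : ℝ) < c := by exact_mod_cast hc'.1
          refine (norm_modulus_sub_main_le hV hK hKl hK₀.le hFd hc₁ hX hg₁ hg₂ h hc'.1 hc'.2 hC'C
            hCC' F hF).trans ?_
          refine per_modulus_alg hK₀.le (Nat.cast_nonneg _) (Real.sqrt_nonneg _)
            (Real.sqrt_pos.mpr hcpos) (Real.mul_self_sqrt hcpos.le) ?_ ?_ (by exact_mod_cast hc'.2)
            hA0 hB0 (by positivity) hKs0 hc₁.le hI₂0 hI₃0 (by positivity)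
          · have := Real.log_nonneg (show (1 : ℝ) ≤ c by exact_mod_cast hc'.1); linarith
          · have := Real.log_le_log hcpos (show (c : ℝ) ≤ C' by exact_mod_cast hc'.2); linarith
      _ = _ := by
          rw [Finset.sum_add_distrib, ← Finset.mul_sum, ← Finset.mul_sum]
      _ ≤ _ := by
          have h1 : 0 ≤ K₀ * (1 + Real.log C') *
              (A * (A * B * (2 * Real.sqrt (q * X)) * (∑' n : ℕ, (n : ℝ) ^ (-(5 / 4 : ℝ))) ^ 2) *
                (2 * (c₁ * ∫ u : ℝ, ((1 + |u|) ^ 2)⁻¹)) +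
              2 * (A * B * (2 * Real.sqrt (q * X)) * (∑' n : ℕ, (n : ℝ) ^ (-(5 / 4 : ℝ))) ^ 2) ^ 2 /
                ((C' : ℝ) + 1) +
              A ^ 2 * (2 * (C' : ℝ)) * (c₁ ^ 2 * ∫ u : ℝ, ((1 + |u|) ^ 3)⁻¹)) := by positivity
          have h2 : 0 ≤ A ^ 2 * (c₁ ^ 2 * ∫ u : ℝ, ((1 + |u|) ^ 3)⁻¹) * ((C' : ℝ) + 1) := by
            positivity
          exact add_le_add (mul_le_mul_of_nonneg_left hwsum h1) (mul_le_mul_of_nonneg_left hgsum h2)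
  -- conclusion
  have hQ := qmax_alg (c₁ := c₁) (I₂ := ∫ u : ℝ, ((1 + |u|) ^ 2)⁻¹)
    (I₃ := ∫ u : ℝ, ((1 + |u|) ^ 3)⁻¹) (Ks := (∑' n : ℕ, (n : ℝ) ^ (-(5 / 4 : ℝ))) ^ 2)
    hA hB hs1 hc₁.le hI₂0 hI₃0 hKs0 (by linarith : (C' : ℝ) ≤ 2 * Real.sqrt (q * X)) hCC'
  have hfin := final_alg (X := X) (q := (q : ℝ)) (k₃ := c₁ ^ 2 * ∫ u : ℝ, ((1 + |u|) ^ 3)⁻¹)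
    hK₀.le (by positivity) (by positivity) hT0 hA hB hs1
    hL1 hX0 hq1 hsC' (by linarith) hlogC' hlogC'0 hsqC' (Real.sqrt_nonneg _) hQ (by positivity)
  rw [hBh, h34]
  calc ‖(∑ c ∈ Finset.Icc 1 C', ∑ d ∈ (Finset.Ioc C' (c + C')).filter (fun d ↦ Nat.Coprime c d),
          ∫ α in (0 : ℝ)..(1 / ((c : ℝ) * d)),
            (F (((((d : ZMod c)⁻¹).val : ℝ)) / c - α) + F (-(((((d : ZMod c)⁻¹).val : ℝ)) / c - α)))) -
        (ciSigma p h : ℂ) * J‖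
      ≤ ‖(∑ c ∈ Finset.Icc 1 C', ∑ d ∈ (Finset.Ioc C' (c + C')).filter (fun d ↦ Nat.Coprime c d),
          ∫ α in (0 : ℝ)..(1 / ((c : ℝ) * d)),
            (F (((((d : ZMod c)⁻¹).val : ℝ)) / c - α) + F (-(((((d : ZMod c)⁻¹).val : ℝ)) / c - α)))) -
          (∑ c ∈ Finset.Icc 1 C', (p c : ℂ) ^ 2 * ramanujanSum c h) * J‖ +
        ‖(∑ c ∈ Finset.Icc 1 C', (p c : ℂ) ^ 2 * ramanujanSum c h) * J - (ciSigma p h : ℂ) * J‖ :=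
        norm_sub_le_norm_sub_add_norm_sub _ _ _
    _ ≤ _ := by
        refine le_trans (add_le_add ?_ hsig) hfin
        rw [Finset.sum_mul, ← Finset.sum_sub_distrib]
        exact (norm_sum_le _ _).trans hE

end CircleMethod

end ConreyIwaniec2002

end Literature.NumberTheory.LFunctions

end
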